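import Mathlib
import HarnessLib
import HarnessLib.Audit
import Summits.CriticalPhenomena.Statement
import Literature.Probability.LatticeModels.RandomCurrents

/-!
Route: OctantEntropy

DORMANT since 2026-09-03T09:44:49Z (reconciler: no traction for 5 d (last activity statement-checked at 2026-08-29T09:08:10Z); parked, not closed — `ledger route dormant route-CriticalPhenomena-OctantEntropy --off` to reactivate) — unstaffed, not closed; items shared with open routes are served there. `ledger route dormant <id> --off` reactivates.

# Route OctantEntropy — eta(3) exists as an entropy — quenched octant-splitting entropy of the
critical sourced double-current cluster, monofractality, switching

It suffices to show X_OE := (Q ∧ M ∧ F) ∧ (C) ∧ (NG), realising card octant-entropy-spin-dimension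
in its lattice-native, zoom-OUT form.
Objects (all existing declarations): the SOURCED critical double current P_{K,L} :=
doubleCurrentMeasure (freeBoxGraph 3 L) (criticalBeta 3) {0, 2^(K+1)e₁} ∅ on the free box graph of
Λ_L ⊂ ℤ³
(sources 0 and y_K = 2^(K+1)e₁ for n₁, none for n₂); mass_K := #(C_{n₁+n₂}(0) ∩ W_K), W_K := [−2^K,
2^K)³ the dyadic window (K+1 octree levels);
a_K := limsup_L E_{K,L}[log₂ mass_K] (QUENCHED log-mass = by the chain rule for Shannon entropy,
EXACTLY the sum over the K+1 levels of the expected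
octant-splitting entropy, in bits, along the mass-driven octree chain of the cluster — Furstenberg's
CP-chain read on the block-spin hierarchy of ℤ³);
b_K := limsup_L log₂ E_{K,L}[mass_K] (ANNEALED); S_K := Σ_{u ∈ W_K} ⟨σ₀σ_u⟩⁺_{β_c(3)}.
(Q) QuenchedMassExponent: a_K / K → D for some D (the mean octant-splitting entropy per level
exists; card (E1)+(E2): zoom-ergodicity ⇒ exact dimension).
(M) MonofractalMass: (b_K − a_K)/K → 0 (card (E3): typical configurations carry the first moment).
(F) FirstMomentBoxSum: (b_K − log₂ S_K)/K → 0 (card (E4): by the switching lemma E_{K,L}[mass_K] =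
Σ_u ⟨σ₀σ_u⟩⟨σ_uσ_y⟩/⟨σ₀σ_y⟩ exactly; the far-source ratio is tempered).
Then log₂ S_K / K → D, and the PROVABLE support BoxSumToEta (Messager–Miracle-Solé in the sup norm +
the Simon–Lieb/infrared window) gives
∃ η, HasIsingExponentEta 3 η with η = 2 − D, i.e. 2Δ_σ = 1 + η = 3 − D: twice the spin dimension is
three bits minus the octant entropy (bootstrap: D = 1.9637).
(C) EtaToMoebiusLimit (IMPORTED COMPLEMENT): given η, the critical correlators have a non-degenerate
Möbius-covariant pointwise scaling limit;
(NG) NonGaussianLimit = shared item stmt-CriticalPhenomena-0636 (U₄ ≢ 0 for every non-degenerate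
limit). The engine (Q, M, F) is this route's content;
(C) and (NG) are the other routes' spines, imported and said so.
Lean: `QuenchedMassExponent ∧ MonofractalMass ∧ FirstMomentBoxSum ∧ EtaToMoebiusLimit ∧
NonGaussianLimit` — the five decls below (full one-line terms under ## Cruxes; every constant is an
existing Literature/Mathlib declaration: Literature.Probability.LatticeModels.doubleCurrentMeasure,
tracedConn, freeBoxGraph, BoxVertex, box, zero_mem_box, criticalBeta, criticalTwoPoint,
HasIsingExponentEta, CorrFamily, HasPointwiseScalingLimit, criticalCorr, IsNondegenerateTwoPoint,
IsMoebiusCovariant, HasNontrivialU4, isingTwoPoint; all items and `theorem assembly_holds :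
Assembly` elaborate rc 0 in the planner's Sketch.lean)

## Assembly
Pure logic plus one line of limit arithmetic (sorry-free in Sketch.lean, theorem assembly_holds):
from Q (a_K/K → D), M ((b_K − a_K)/K → 0) and
F ((b_K − log₂ S_K)/K → 0) the identity log₂ S_K/K = a_K/K + (b_K − a_K)/K − (b_K − log₂ S_K)/K
(ring, valid also at K = 0 with x/0 = 0) gives
log₂ S_K/K → D; BoxSumToEta yields ∃ η, HasIsingExponentEta 3 η; EtaToMoebiusLimit turns it into (ρ,
Δ, S) with ρ > 0 on (0,1], Δ > 0,
HasPointwiseScalingLimit (criticalCorr 3) ρ S, IsNondegenerateTwoPoint S, IsMoebiusCovariant Δ S;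
NonGaussianLimit ρ S gives HasNontrivialU4 S;
this is Ising3DConformalLimit (= Literature.Probability.LatticeModels.CritIsing3DConformalLimit).

Rationale: WHY THIS LINE. The card transplants the ergodic theory of fractal distributions (Furstenberg2008
CP-chains: dim = mean splitting entropy / log b; Hochman2010FractalDistributions Thm 1.7,
L.1.18/P.1.19: uniformly scaling ⇒ exact dimensional; HochmanShmerkin2012 §§1.2–1.4) onto the
critical sourced double-current cluster of ℤ³ with an explicit dictionary: octree of ℤ³ = block-spin
hierarchy, CP step = mass-biased choice of a sub-cube, fractal distribution = tangent critical
cluster, ergodicity of the zoom = 'the critical point is a fixed point or a cycle, not a wandering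
orbit'. Read in the coarse (zoom-out) direction, where HasIsingExponentEta lives, the imported
dimension formula becomes the chain rule for Shannon entropy (an identity), so the whole analytic
burden 'a limit of log-ratios exists' is converted into the convergence of ONE ergodic-type average,
crux Q, exactly as sub-additivity converts the connective constant into one inequality; Q tolerates
log-periodic modulation (an RG limit cycle still has convergent Cesàro entropy), which the
power-BOUND routes do not. The choice of SOURCED double currents (AizenmanCMP1982 switching lemma;
in tree and PROVED: currentSum_mul_currentSum_pair_holds) makes the first moment of the cluster mass
EQUAL to a two-point expression with no hyperscaling (an FK or sourceless-current cluster would need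
one-arm or bubble input), and the transfer from the window sum S_K to η is provable now from
twoPointPlus_le_of_mul_supNorm_le (AizenmanDuminilCopinAnnals2021 eq. (5.3), proved in tree) and
criticalTwoPoint_bounds_holds. What is new relative to the two-point routes (IsingEuclidUpgrade r3 =
item 0635 'η exists', PerfectScreening, inverse-square/Karamata cards): the exponent is produced
from the statistics of ONE random geometric object by an entropy/ergodic mechanism with a formula (η
= 2 − D) and a renormalisation-free Monte-Carlo estimator (mean octant entropy must plateau at 1.964
bits), not from real-variable regularity of the sequence ⟨σ₀σ_x⟩. Areas imported: ergodic theory /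
fractal geometry (CP-chains, Shannon–McMillan–Breiman), percolation-type representations (random
currents, Panis2025 current IIC for the infinite-volume picture). docs/m5/inspiration not read
(plancard mode).

RANKED CRUXES. #2 QuenchedMassExponent (crux) — (Q) of the card, lattice form of (E1)+(E2): there is
D such that a_K/K → D, where a_K = limsup_{L→∞} E_{K,L}[log₂ #(C_{n₁+n₂}(0) ∩ [−2^K,2^K)³)] under
the critical double current on the free box graph of Λ_L with sources {0, 2^(K+1)e₁} (n₁) and ∅
(n₂). Equivalently (chain rule): the Cesàro mean over octree levels of the expected octant-splitting
entropy (bits) of the source cluster converges. Intended proof: zoom-ergodicity (uniform scaling) of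
the critical current cluster ⇒ level entropies converge (Furstenberg/Hochman, coarse direction).
Trivial bounds: a_K/K ∈ [1, 3+3/K] (the cluster joins 0 to y_K). [difficulty: open-problem] (why it
might fail: the level entropies h_k may wander (neither converge nor cycle): uniform scaling is open
even for 2-D critical clusters (CLE carpets) and no mixing-across-scales theorem for one
configuration exists in d = 3 (ADC21 mixing is across space).) [Furstenberg2008,
Hochman2010FractalDistributions, HochmanShmerkin2012, arXiv:1312.2567, Panis2025,
AizenmanDuminilCopinAnnals2021, DuminilCopinICM2022]
#3 MonofractalMass (crux) — (M) of the card (E3), monofractality of the source-cluster mass: (b_K −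
a_K)/K → 0 with b_K = limsup_L log₂ E_{K,L}[mass_K] (annealed) and a_K as in QuenchedMassExponent
(quenched); b_K ≥ a_K by Jensen. Tools: second-moment (tree-diagram) bounds for sourced currents
give the upper tail; the lower tail needs 'no thin clusters': mass_K ≥ E[mass_K]·2^(−εK) with
probability → 1. [deps: QuenchedMassExponent] [difficulty: L] (why it might fail: multifractal
cluster mass: E[mass_K] could be carried by configurations of probability 2^(−cK) (fat upper tail)
or typical clusters could be thinner than the mean by a power; ADC21 second-moment control is at
regular scales only, all scales need doubling.) [AizenmanDuminilCopinAnnals2021, arXiv:1912.07973,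
Panis2025, DuminilcopinPanis2025]
#4 FirstMomentBoxSum (crux) — (F), the card's (E4) in log form: (b_K − log₂ S_K)/K → 0, S_K = Σ_{u ∈
[−2^K,2^K)³} ⟨σ₀σ_u⟩⁺_{β_c(3)}. By SwitchingFirstMoment (support, exact) E_{K,L}[mass_K] = Σ_u
⟨σ₀σ_u⟩_L⟨σ_uσ_y⟩_L/⟨σ₀σ_y⟩_L; L → ∞ gives the infinite-volume free = plus state
(twoPointPlus_criticalBeta_eq_twoPointFree_holds), so F says the far-source weights ⟨σ_uσ_y⟩/⟨σ₀σ_y⟩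
(u ∈ W_K, y = 2^(K+1)e₁) are 2^(o(K)): TEMPERED DOUBLING of the critical two-point function, G(2^K
e₁/3)/G(6·2^K e₁) = 2^(o(K)). Necessary for the conclusion (η exists ⇒ F), so no loss. [difficulty:
L] (why it might fail: a log-log 'staircase' two-point function (flat stretches then drops by a
factor up to 2^K, compatible with MMS, GKS and c‖x‖⁻² ≤ G ≤ C‖x‖⁻¹) has doubling ratio 2^(Θ(K))
along a sequence of K; doubling is known at ADC21 regular scales only.) [AizenmanCMP1982,
Literature.Probability.LatticeModels.currentSum_mul_currentSum_pair_holds,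
Literature.Probability.LatticeModels.twoPointPlus_le_of_mul_supNorm_le, arXiv:1912.07973,
DuminilcopinPanis2025]
#5 EtaToMoebiusLimit (crux) — IMPORTED COMPLEMENT (lowest of this route's own cruxes; this route
does not attack it and says so): if the anomalous dimension η of the critical Ising model on ℤ³
exists, then the critical correlators have a non-degenerate Möbius-covariant pointwise scaling limit
(ρ > 0 on (0,1], Δ > 0, S) — the conjunct minus clause (iii), CONDITIONAL on item 0635. The
consequent is verbatim the shared complement MoebiusLimit (stmt-CriticalPhenomena-1344, routes
AnomalousForcesInteraction / PerfectScreening); the antecedent is what the engine supplies and is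
load-bearing: with η in hand isingScalingRelationHolds pins Δ = (1+η)/2 for EVERY subsequential
scale-covariant non-degenerate limit (no competing Δ's) and fixes ρ(δ) up to slowly varying factors.
[difficulty: open-problem] (why it might fail: η may exist while the conjunct fails: no uniqueness
of subsequential limits beyond n ≤ 3, rotation invariance and inversion covariance open on ℤ³
(ICM2022 §8.1, §8.4); ScaleCovarianceNotMoebius: Euclidean+scale data never force inversion.)
[DuminilCopinICM2022, PolandRychkovVichi2019,
Literature.Barriers.CriticalPhenomena.ScaleCovarianceNotMoebius,
Literature.Probability.LatticeModels.isingScalingRelationHolds,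
Literature.Probability.LatticeModels.CritIsing3DEuclideanLimit]
#6 NonGaussianLimit (crux) — shared item stmt-CriticalPhenomena-0636 verbatim (IsingEuclidUpgrade
r4, HyperoctahedralRP r6): every non-degenerate pointwise scaling limit of the renormalised critical
Ising correlators on ℤ³ has U₄ ≢ 0. Imported; supplies clause (iii). [difficulty: open-problem] (why
it might fail: no proof that U₄ ≢ 0 in d = 3: the double-current intersection probability at
macroscopic separation must stay positive as δ → 0; RP long-range models on ℤ³ with α < 3/2 ARE
Gaussian (LongRangeTrivialityOnZ3).) [AizenmanDuminilCopinAnnals2021, Panis2023Triviality,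
DuminilCopinICM2022, Literature.Barriers.CriticalPhenomena.IsingTrivialityFromDimensionFour,
Literature.Barriers.CriticalPhenomena.LongRangeTrivialityOnZ3]
#9 SwitchingFirstMoment (support) — exact first-moment identity (card (E4), finite volume, provable
now from the PROVED switching lemma currentSum_mul_currentSum_pair_holds with A = {o,u}, and
isingTwoPoint_free_eq_currentSum_div_holds): for 2^(K+1) ≤ L, o = 0, y = 2^(K+1)e₁ in the free box
graph of Λ_L at β_c(3), E_{K,L}[#(C_{n₁+n₂}(o) ∩ W_K)] = Σ_{u ∈ W_K} ⟨σ_oσ_u⟩⟨σ_uσ_y⟩/⟨σ_oσ_y⟩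
(finite-volume free two-point functions; P^{oy,∅}[u ∈ C(o)] = ⟨σ_oσ_u⟩⟨σ_uσ_y⟩/⟨σ_oσ_y⟩ since o ↔ y
in n₁ always). [difficulty: provable-now] [AizenmanCMP1982, GriffithsHurstSherman1970,
DuminilCopin2016, Literature.Probability.LatticeModels.currentSum_mul_currentSum_pair_holds]
#9 BoxSumToEta (support) — Tauberian transfer, provable now: if log₂ S_K / K → s (S_K the
dyadic-window two-point sum) then η := 2 − s is the anomalous dimension, HasIsingExponentEta 3 η.
Proof: S monotone in the window ⇒ log S(R)/log R → s; upper bound G(x) ≤ S(‖x‖/3)/#Λ_{‖x‖/3} from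
card_box_mul_twoPointPlus_le_sum_box (MMS, ‖y‖∞ ≥ 3‖x‖∞ ⇒ G(y) ≤ G(x)); lower bound G(x) ≥ (S(N) −
S(3‖x‖))/#Λ_N with N = (3‖x‖)^(1+ε) and S(N) ≥ 2S(3‖x‖) eventually because s ≥ 1 > 0
(criticalTwoPoint_bounds_holds: c‖x‖⁻² ≤ G ≤ C‖x‖⁻¹); let ε → 0. [difficulty: provable-now]
[MessagerMiracleSoleJSP1977, Literature.Probability.LatticeModels.twoPointPlus_le_of_mul_supNorm_le,
Literature.Probability.LatticeModels.card_box_mul_twoPointPlus_le_sum_box,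
Literature.Probability.LatticeModels.criticalTwoPoint_bounds_holds, Simon1980]
#9 EtaExists (support) — WAYPOINT, not glue: the engine's output = shared item
stmt-CriticalPhenomena-0635 (IsingEuclidUpgrade r3) 'the anomalous dimension η(3) exists in the
logarithmic sense'; inside this route it follows as QuenchedMassExponent → MonofractalMass →
FirstMomentBoxSum → BoxSumToEta → EtaExists (the limit arithmetic of assembly_holds); filed so the
ledger links this engine to 0635. [difficulty: open-problem] [DuminilCopinICM2022,
DuminilcopinPanis2025, Literature.Probability.LatticeModels.HasIsingExponentEta]

TWO-LAYER PLAN. Foreseen glued splits (none filed now; k ≤ 3, depth 1). Q ⇐ ZoomErgodic →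
CoarseFurstenberg → Q: ZoomErgodic = the mass-driven octree CP-chain of
the source cluster started at level K converges in Cesàro law (levels k = 0..K, K → ∞, L → ∞) to a
unique stationary ergodic CP-distribution P*
on normalised measures of the unit cube (uniform scaling in CP form; needs the definition requests
OctreeCPChain / OctantSplittingEntropy);
CoarseFurstenberg = ZoomErgodic ⇒ a_K/K → E_{P*}[H₈]/1 bit-normalised (the imported theorem
re-proved in the zoom-out direction: here the
per-level entropy is a bounded continuous functional of the chain state, so Cesàro convergence in
law suffices; plus the EXACT chain-rule
identity a_{K,L} = Σ_levels E[H₈(split)] for the uniform measure on a finite subset of a dyadic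
cube, a provable-now support lemma).
M ⇐ UpperTailUI → NoThinClusters → M: UpperTailUI = E_{K,L}[mass_K²] ≤ 2^(o(K)) E_{K,L}[mass_K]²
(tree bound for sourced currents,
ADC21 §4/Prop. A-type), NoThinClusters = P_{K,L}[mass_K ≤ 2^(−εK) E mass_K] → 0 for every ε > 0.
F ⇐ ThermodynamicLimitOfWeights → TemperedDoubling → F: TemperedDoubling = log G(⌊2^K/3⌋e₁) − log
G(6·2^K e₁) = o(K) for G = criticalTwoPoint 3
(a pure two-point statement, necessary for η), the first child being bookkeeping (finite-volume free
→ infinite-volume plus two-point functions at β_c).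

KILL CRITERIA. (a) A Monte-Carlo or rigorous demonstration that the mean octant-splitting entropy of
critical sourced-current clusters does NOT plateau
(drift or non-periodic oscillation of h_k across levels k = 2..7 at L = 256; card's fastest
refutation) refutes the mechanism behind Q — close
`refuted:QuenchedMassExponent` if Q itself is refuted (e.g. by a rigorous wandering example in a
model where the rest of the chain holds), else
pivot Q to its Cesàro-in-law child. (b) A proof that the source-cluster mass is multifractal at
criticality (typical mass 2^(K(D−c)) below the
mean) refutes M and closes the route: the entropy then computes the information dimension, not η.
(c) TemperedDoubling refuted (a staircase
G at β_c(3)) refutes F AND ¬(η exists): it kills item 0635 and every single-Δ route, file ¬0635. (d)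
Item 0635 proved elsewhere (Karamata /
inverse-square / Fekete cards) moots the engine; the route then closes `superseded` unless the
entropy formula η = 2 − D is wanted on its own.
(e) Refutation of NonGaussianLimit (a Gaussian non-degenerate limit) kills the conjunct itself, not
just this route.

NOT DECOMPOSED YET. The uniform-scaling hypothesis itself (ZoomErgodic) and the CP-chain vocabulary
(definition requests below) — layer-2 children of Q once a
grounder stamps Q; the infinite-volume sourced double current P^{0∞} / current IIC (Panis2025) that
would turn limsup_L into lim_L (we state
everything with limsup over L so no construction is presupposed); the second-moment and thin-cluster
estimates behind M; the thermodynamic-limit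
bookkeeping (free box graph → infinite-volume plus state) inside F; isotropy / O(3)-invariance of
the tangent distribution P* (card (E6), fed by
the isotropy cards, not needed for η); everything inside the imported complement EtaToMoebiusLimit
(existence, rotations, inversion: other routes).
No Target item: X_OE is the conjunction of the five cruxes.

CHEAPEST FALSIFIER. Numerical, cheap, decisive for the MECHANISM: sample critical sourced double
currents on ℤ³ (worm algorithm, L = 128–256, sources 0 and
2^(K+1)e₁), run the mass-driven octree chain on C(0) ∩ [−2^K,2^K)³ and average the octant-splitting
entropy per level: the card predicts a
plateau at D = 3 − 2Δ_σ = 1.9637 bits (Δ_σ = 0.5181489, KosPolandSimmonsDuffinVichi2016) for levels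
with cells ≫ 1; equivalently
E[log₂ mass_K] − K·1.9637 = O(1) and log₂ E[mass_K] − E[log₂ mass_K] = O(1) (monofractality). A
drift of the per-level entropy, or a growing
annealed–quenched gap, retires Q resp. M. Not run here (kit not in this unit's payload); the 2-D
analogue (D₂ = 2 − 2·(1/8)·… = 1.75 bits for
the planar sourced current, Δ = 1/8) is the calibration run. Rigorous cheapest check: BoxSumToEta
and SwitchingFirstMoment are provable now —
if either fails to close within a prover cycle the typing of the engine is wrong.

NUMBERS. Δ_σ = 0.5181489(10) (KosPolandSimmonsDuffinVichi2016) ⇒ η = 0.0362978, D = 2 − η = 1.9637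
bits per octree level, 2Δ_σ = 3 − D.
Rigorous window: c‖x‖⁻² ≤ ⟨σ₀σ_x⟩_{β_c(3)} ≤ C‖x‖⁻¹ (criticalTwoPoint_bounds_holds) ⇒ s = lim log₂
S_K/K ∈ [1,2] if it exists, D ∈ [1,2],
η ∈ [0,1]; η ≤ 1/2 if it exists (DuminilcopinPanis2025 Thm 1.5). Trivial bounds on the engine: K ≤
log₂ mass_K ≤ 3(K+1). d = 2 calibration:
D = 2 − η = 1.75 bits of quadrant entropy; d ≥ 5: D = 2 bits (two Brownian strands). Items at open:
9 (5 cruxes, 3 support, 1 assembly).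

DEFINITION REQUESTS. To type the layer-2 children of Q (filed after open with `ledger workitem add
--kind definition`): (D1) OctreeCPChain — for a finite measure
on a dyadic cube of ℤ³ (or a Radon measure on [0,1]³), the Markov chain on nested dyadic sub-cubes
choosing a child with probability
proportional to its mass (Furstenberg2008 §1; Hochman2010FractalDistributions §1.4), with its
level-k state = the normalised restricted
measure blown up to the unit cube; (D2) OctantSplittingEntropy — H₈(μ, Q) = Shannon entropy of
(μ(Q_j)/μ(Q))_{j=1..8} over the eight
children of a cube Q, and the chain-rule identity Σ_levels E_chain[H₈] = H(μ) for purely atomic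
uniform μ; (D3) (optional, Literature
topic Dynamics/FractalGeometry) CPDistribution / IsUniformlyScaling (Hochman2010FractalDistributions
Def. 1.4–1.6, 1.17) as an interface
with the dimension formula dim = E[H_b^d]/log b as a NAMED FACT (Furstenberg2008 Thm 2.1;
Hochman2010FractalDistributions Prop. 1.19).
No cite-fact is needed by the items as typed (they mention definitions only; the switching lemma and
MMS comparison they rest on are PROVED in tree).

Novelty: Searches (2026-08-15, this session): `lit search --hybrid "scenery flow fractal distribution
uniformly scaling"` (local, 15 generic fractal
textbooks, nothing on lattice models); zbMATH: "scenery flow percolation" (1 Oberwolfach report),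
"CP-chain random fractal dimension" (0),
"fractal distributions Galton-Watson" (3: Zähle 1988 doi:10.1002/mana.19881370105, Uchaikin et al.
1998, Charmoy–Croydon–Hambly 2017),
"uniformly scaling" (15, only Fraser–Pollicott arXiv:1502.05610 relevant), "incipient infinite
cluster random current Ising" (Panis2025 =
arXiv:2406.15243); Semantic Scholar "fractal percolation scenery flow" (Käenmäki–Sahlsten–Shmerkin
arXiv:1312.2567 'Structure of distributions
generated by the scenery flow'); crossref "information dimension percolation cluster mass
multifractal" (physics box-counting of cluster
dimensions only, e.g. Voss 1984 doi:10.1088/0305-4470/17/7/001); `lit frontier CriticalPhenomena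
--since 2021` (30 rows; relevant: Zhu–Chen–
Li–Fang–Deng arXiv:2604.05772, MC fractal dimensions of 3-D Ising FK/geometric clusters, READ pp.1–2
— box counting, no entropy, no currents);
`lit galaxy search … --star all|pdf|panama` attempted 3× (service saturated, queued > 90 s each;
recorded, not retried further); OpenAlex/arXiv API
429 (daily budget). Card-level audit (refuter-novelty-audit-…-8-0, who READ Hochman
L.1.18/P.1.19/§4.4 and Falconer–Jin pp.8–9): new-combination.
Nearest prior art found: Furstenberg2008 (doi:10.1017/S0143385708000084; CP-chains, dim =  [refs: 10.1002/mana.19881370105, 10.1088/0305-4470/17/7/001, 10.1017/S0143385708000084, 1502.05610, 2406.15243, 1312.2567, 2604.05772, 1008.3731, 0910.1956, 1912.07973, doi:10.1002/mana.19881370105, doi:10.1088/0305-4470/17/7/001, doi:10.1017/S0143385708000084, Panis2025, Furstenberg2008, HochmanShmerkin2012, AizenmanCMP1982, AizenmanDuminilCopinAnnals2021, DuminilcopinPanis2025]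

Barriers (technique_class: ergodic-fractal-distributions, random-currents): - technique_class: ergodic-fractal-distributions, random-currents
- Literature.Barriers.CriticalPhenomena.RigorousRGSmallParameter: evaded by construction — no RG map
near a Gaussian fixed point and no small parameter; the only 'renormalisation' is the zoom of one
configuration's cluster mass down the octree (always defined), whose invariant distribution exists
by compactness and whose UNIQUENESS/ergodicity is crux Q, stated at ε = 1 directly.
- Literature.Barriers.CriticalPhenomena.PositionSpaceRGNonGibbsian: evaded — nothing acts on
Hamiltonians; the CP-chain acts on measures/configurations (the barrier's own recorded evasion (c)
'let the RG act on measures'), and no renormalised interaction is ever needed.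
- Literature.Barriers.CriticalPhenomena.IsingTrivialityFromDimensionFour: not engaged — the engine
(Q, M, F, BoxSumToEta) is dimension-uniform ON PURPOSE and its output 'η exists' is true in every d
(η = 0, D = 2 bits for d ≥ 5); non-triviality (clause iii) is not derived but imported as
NonGaussianLimit (item 0636), where the d = 3 input must enter.
- Literature.Barriers.CriticalPhenomena.LongRangeTrivialityOnZ3: not engaged for the same reason (no
interaction-uniform non-triviality argument; the switching identity is nearest-neighbour bookkeeping
only).
- Literature.Barriers.CriticalPhenomena.LaceExpansionIsingAboveFour: not met — no expansion, no
bubble condition; the output is existence of η with unspecified value.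
- Literature.Barriers.CriticalPhenomena.ScaleCovaria

History (route lifecycle, newest last):
- 2026-08-15T17:24:43Z · rev 3: restated QuenchedMassExponent (stmt-CriticalPhenomena-5732), MonofractalMass (stmt-CriticalPhenomena-5733), FirstMomentBoxSum (stmt-CriticalPhenomena-5734), SwitchingFirstMoment (stmt-CriticalPhenomena-5736) — cone repair (rrepair g3): the 18 unproved named facts of the import cone (aizenman_higuchi, bodineau_tr (planner-rrepair-CriticalPhenomena-OctantEntrop-f1903d4f-g3-0)
- 2026-08-24T06:31:22Z · DORMANT — reconciler: no traction for 6.6 d (last activity item-evidence-added at 2026-08-17T16:05:46Z); parked, not closed — `ledger route dormant route-CriticalPhenomen (operator:999:3714894)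
- 2026-08-27T15:27:58Z · REACTIVATED — reconciler: reactivated — activity statement-checked at 2026-08-27T13:50:46Z after parking at 2026-08-24T06:31:22Z (operator:999:1896817)
- 2026-09-03T09:44:49Z · DORMANT — reconciler: no traction for 5 d (last activity statement-checked at 2026-08-29T09:08:10Z); parked, not closed — `ledger route dormant route-CriticalPhenomena-Oc (operator:999:3958259)

sub-problem: Ising3DConformalLimit · status: dormant · opened planner-plancard-CriticalPhenomena-Ising3DCon-e5150e7e-0 2026-08-15T11:42:16Z · rev 4 · ledger route-CriticalPhenomena-OctantEntropy
GENERATED by the gate from the ledger (D-0016/17). Provers cite these decls: `theorem foo : Summit.CriticalPhenomena.Ising3DConformalLimit.Theses.OctantEntropy.<Decl> := …` in Summits/CriticalPhenomena/Ising3DConformalLimit/Theorems/<Name>.lean.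
-/

namespace Summit.CriticalPhenomena.Ising3DConformalLimit.Theses.OctantEntropy

open scoped BigOperators Topology Manifold Classical MeasureTheory ProbabilityTheory Matrix InnerProductSpace ComplexConjugate ContinuousMap
open Filter Set Function TopologicalSpace MeasureTheory

attribute [summit_statement] _root_.Ising3DConformalLimit

-- earlier QuenchedMassExponent (stmt-CriticalPhenomena-5732, replaced 2026-08-15T17:24:43Z -> stmt-CriticalPhenomena-11352): retired by None — ∃ D : ℝ, Filter.Tendsto (fun K : ℕ => Filter.limsup (fun L : ℕ => ∫ p, Real.logb 2 ((Finset.univ.filter fun u : Literature.Probability.LatticeModels.BoxVertex 3 L => (∀ i, -(2 ^ K : ℤ) ≤ (u : Literature.Probability.LatticeModels.Site 3) i ∧ (u : Literature.Pr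
/-- item stmt-CriticalPhenomena-11352 · crux · rank 2 · open · by planner
why it might fail: the per-level octant entropies h_k may wander (neither converge nor cycle): uniform scaling of a critical cluster is unproved even in d=2 (CLE carpets); ADC21 Thm 6.4 decouples an inner box from a far annulus, no ergodic theorem along the scales of ONE cluster; even 'η(3) exists' is open (ICM22 §8).
sources: Furstenberg2008, Hochman2010FractalDistributions, HochmanShmerkin2012, arXiv:1312.2567, Panis2025, AizenmanDuminilCopinAnnals2021
[crux] (Q) of the card, lattice form of (E1)+(E2): there is D such that a_K/K → D, where a_K =
limsup_{L→∞} E_{K,L}[log₂ #(C_{n₁+n₂}(0) ∩ [−2^K,2^K)³)] under the critical double current on the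
free box graph of Λ_L with sources {0, 2^(K+1)e₁} (n₁) and ∅ (n₂). Equivalently (chain rule): the
Cesàro mean over octree levels of the expected octant-splitting entropy (bits) of the source cluster
converges. Intended proof: zoom-ergodicity (uniform scaling) of the critical current cluster ⇒ level
entropies converge (Furstenberg/Hochman, coarse direction). Trivial bounds: a_K/K ∈ [1, 3+3/K] (the
cluster joins 0 to y_K). [difficulty: open-problem] NOTATION (rev-3 cone repair; statement
DEFINITIONALLY unchanged): the vertex type ↥(box 3 (L+1)) is `BoxVertex 3 L` (abbrev) and the graph
G_L := SimpleGraph.mk (fun a b => (zdGraph 3).Adj a.1 b.1 ∧ ↑a ∈ box 3 L ∧ ↑b ∈ box 3 L) ⟨…⟩ ⟨…⟩ is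
`Literature.Probability.LatticeModels.freeBoxGraph 3 L` unfolded (`rfl`); this decl ↔ the rev-2 item
stmt-CriticalPhenomena-5732 by `Iff.rfl` (planner evidence SketchDefeq.lean, rc 0), so the grounding
(grounder g13-38) and route-review check (refuter ec82786d) recorded on stmt-CriticalPhenomena-5732
apply verbatim -/
@[route_item "route-CriticalPhenomena-OctantEntropy"]
def QuenchedMassExponent : Prop :=
  ∃ D : ℝ, Filter.Tendsto (fun K : ℕ => Filter.limsup (fun L : ℕ => ∫ p, Real.logb 2 ((Finset.univ.filter fun u : ↥(Literature.Probability.LatticeModels.box 3 (L + 1)) => (∀ i, -(2 ^ K : ℤ) ≤ (u : Literature.Probability.LatticeModels.Site 3) i ∧ (u : Literature.Probability.LatticeModels.Site 3) i < 2 ^ K) ∧ p ∈ Literature.Probability.LatticeModels.tracedConn ((SimpleGraph.mk (fun a b : ↥(Literature.Probability.LatticeModels.box 3 (L + 1)) => (Literature.Probability.LatticeModels.zdGraph 3).Adj a.1 b.1 ∧ (a : Literature.Probability.LatticeModels.Site 3) ∈ Literature.Probability.LatticeModels.box 3 L ∧ (b : Literature.Probability.LatticeModels.Site 3) ∈ Literature.Probability.LatticeModels.box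 3 L) ⟨fun _ _ h => ⟨h.1.symm, h.2.2, h.2.1⟩⟩ ⟨fun _ h => h.1.ne rfl⟩)) ⟨0, Literature.Probability.LatticeModels.zero_mem_box 3 (L + 1)⟩ u).card : ℝ) ∂(Literature.Probability.LatticeModels.doubleCurrentMeasure ((SimpleGraph.mk (fun a b : ↥(Literature.Probability.LatticeModels.box 3 (L + 1)) => (Literature.Probability.LatticeModels.zdGraph 3).Adj a.1 b.1 ∧ (a : Literature.Probability.LatticeModels.Site 3) ∈ Literature.Probability.LatticeModels.box 3 L ∧ (b : Literature.Probability.LatticeModels.Site 3) ∈ Literature.Probability.LatticeModels.box 3 L) ⟨fun _ _ h => ⟨h.1.symm, h.2.2, h.2.1⟩⟩ ⟨fun _ h => h.1.ne rfl⟩)) (Literature.Probability.LatticeModels.criticalBeta 3) (Finset.univ.filter fun v : ↥(Literature.Probability.LatticeModels.box 3 (L + 1)) => (v : Literature.Probability.LatticeModels.Site 3) = 0 ∨ (v : Literature.Probability.LatticeModels.Site 3) = Pi.single 0 (2 ^ (K + 1))) ∅)) Filter.atTop / (K : ℝ)) Filter.atTop (nhds D)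

-- earlier MonofractalMass (stmt-CriticalPhenomena-5733, replaced 2026-08-15T17:24:43Z -> stmt-CriticalPhenomena-11353): retired by None — Filter.Tendsto (fun K : ℕ => (Filter.limsup (fun L : ℕ => Real.logb 2 (∫ p, ((Finset.univ.filter fun u : Literature.Probability.LatticeModels.BoxVertex 3 L => (∀ i, -(2 ^ K : ℤ) ≤ (u : Literature.Probability.LatticeModels.Site 3) i ∧ (u : Literature.Probability.La
/-- item stmt-CriticalPhenomena-11353 · crux · rank 3 · open · by planner
why it might fail: typical clusters may be thinner than the mean by a power with non-vanishing probability: two switchings + Newman's Gaussian bound give E[mass_K²] ≲ E[mass_K]² at tempered scales, but Paley–Zygmund yields only P[mass ≥ θ·E mass] ≥ c, not → 1; no lower-tail bound for critical sourced currents on ℤ³.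
sources: AizenmanCMP1982, AizenmanDuminilCopinAnnals2021, arXiv:1912.07973, Panis2025, DuminilcopinPanis2025
[crux] (M) of the card (E3), monofractality of the source-cluster mass: (b_K − a_K)/K → 0 with b_K =
limsup_L log₂ E_{K,L}[mass_K] (annealed) and a_K as in QuenchedMassExponent (quenched); b_K ≥ a_K by
Jensen. Tools: second-moment (tree-diagram) bounds for sourced currents give the upper tail; the
lower tail needs 'no thin clusters': mass_K ≥ E[mass_K]·2^(−εK) with probability → 1. [deps:
QuenchedMassExponent] [difficulty: L] NOTATION (rev-3 cone repair; statement DEFINITIONALLY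
unchanged): the vertex type ↥(box 3 (L+1)) is `BoxVertex 3 L` (abbrev) and the graph G_L :=
SimpleGraph.mk (fun a b => (zdGraph 3).Adj a.1 b.1 ∧ ↑a ∈ box 3 L ∧ ↑b ∈ box 3 L) ⟨…⟩ ⟨…⟩ is
`Literature.Probability.LatticeModels.freeBoxGraph 3 L` unfolded (`rfl`); this decl ↔ the rev-2 item
stmt-CriticalPhenomena-5733 by `Iff.rfl` (planner evidence SketchDefeq.lean, rc 0), so the grounding
(grounder g13-38) and route-review check (refuter ec82786d) recorded on stmt-CriticalPhenomena-5733
apply verbatim; provers may `show`/`change` to the freeBoxGraph form and use DoubleCurrents /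
SourcedDoubleCurrents(Switching) lemmas inside their Theorems file. Inlined only so that the ROUTE
FILE imports RandomCurrents (all 11 -/
@[route_item "route-CriticalPhenomena-OctantEntropy"]
def MonofractalMass : Prop :=
  Filter.Tendsto (fun K : ℕ => (Filter.limsup (fun L : ℕ => Real.logb 2 (∫ p, ((Finset.univ.filter fun u : ↥(Literature.Probability.LatticeModels.box 3 (L + 1)) => (∀ i, -(2 ^ K : ℤ) ≤ (u : Literature.Probability.LatticeModels.Site 3) i ∧ (u : Literature.Probability.LatticeModels.Site 3) i < 2 ^ K) ∧ p ∈ Literature.Probability.LatticeModels.tracedConn ((SimpleGraph.mk (fun a b : ↥(Literature.Probability.LatticeModels.box 3 (L + 1)) => (Literature.Probability.LatticeModels.zdGraph 3).Adj a.1 b.1 ∧ (a : Literature.Probability.LatticeModels.Site 3) ∈ Literature.Probability.LatticeModels.box 3 L ∧ (b : Literature.Probability.LatticeModels.Site 3) ∈ Literature.Probability.LatticeModels.box 3 L) ⟨fun _ _ h => ⟨h.1.symm, h.2.2, h.2.1⟩⟩ ⟨fun _ h => h.1.ne rfl⟩)) ⟨0, Literature.Probability.LatticeModels.zero_mem_box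 3 (L + 1)⟩ u).card : ℝ) ∂(Literature.Probability.LatticeModels.doubleCurrentMeasure ((SimpleGraph.mk (fun a b : ↥(Literature.Probability.LatticeModels.box 3 (L + 1)) => (Literature.Probability.LatticeModels.zdGraph 3).Adj a.1 b.1 ∧ (a : Literature.Probability.LatticeModels.Site 3) ∈ Literature.Probability.LatticeModels.box 3 L ∧ (b : Literature.Probability.LatticeModels.Site 3) ∈ Literature.Probability.LatticeModels.box 3 L) ⟨fun _ _ h => ⟨h.1.symm, h.2.2, h.2.1⟩⟩ ⟨fun _ h => h.1.ne rfl⟩)) (Literature.Probability.LatticeModels.criticalBeta 3) (Finset.univ.filter fun v : ↥(Literature.Probability.LatticeModels.box 3 (L + 1)) => (v : Literature.Probability.LatticeModels.Site 3) = 0 ∨ (v : Literature.Probability.LatticeModels.Site 3) = Pi.single 0 (2 ^ (K + 1))) ∅))) Filter.atTop - Filter.limsup (fun L : ℕ => ∫ p, Real.logb 2 ((Finset.univ.filter fun u : ↥(Literature.Probability.LatticeModels.box 3 (L + 1)) => (∀ i, -(2 ^ K : ℤ) ≤ (u : Literature.Probability.LatticeModels.Site 3) i ∧ (u : Literature.Probability.LatticeModels.Site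 3) i < 2 ^ K) ∧ p ∈ Literature.Probability.LatticeModels.tracedConn ((SimpleGraph.mk (fun a b : ↥(Literature.Probability.LatticeModels.box 3 (L + 1)) => (Literature.Probability.LatticeModels.zdGraph 3).Adj a.1 b.1 ∧ (a : Literature.Probability.LatticeModels.Site 3) ∈ Literature.Probability.LatticeModels.box 3 L ∧ (b : Literature.Probability.LatticeModels.Site 3) ∈ Literature.Probability.LatticeModels.box 3 L) ⟨fun _ _ h => ⟨h.1.symm, h.2.2, h.2.1⟩⟩ ⟨fun _ h => h.1.ne rfl⟩)) ⟨0, Literature.Probability.LatticeModels.zero_mem_box 3 (L + 1)⟩ u).card : ℝ) ∂(Literature.Probability.LatticeModels.doubleCurrentMeasure ((SimpleGraph.mk (fun a b : ↥(Literature.Probability.LatticeModels.box 3 (L + 1)) => (Literature.Probability.LatticeModels.zdGraph 3).Adj a.1 b.1 ∧ (a : Literature.Probability.LatticeModels.Site 3) ∈ Literature.Probability.LatticeModels.box 3 L ∧ (b : Literature.Probability.LatticeModels.Site 3) ∈ Literature.Probability.LatticeModels.box 3 L) ⟨fun _ _ h => ⟨h.1.symm, h.2.2, h.2.1⟩⟩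 ⟨fun _ h => h.1.ne rfl⟩)) (Literature.Probability.LatticeModels.criticalBeta 3) (Finset.univ.filter fun v : ↥(Literature.Probability.LatticeModels.box 3 (L + 1)) => (v : Literature.Probability.LatticeModels.Site 3) = 0 ∨ (v : Literature.Probability.LatticeModels.Site 3) = Pi.single 0 (2 ^ (K + 1))) ∅)) Filter.atTop) / (K : ℝ)) Filter.atTop (nhds 0)

-- earlier FirstMomentBoxSum (stmt-CriticalPhenomena-5734, replaced 2026-08-15T17:24:43Z -> stmt-CriticalPhenomena-11354): retired by None — Filter.Tendsto (fun K : ℕ => (Filter.limsup (fun L : ℕ => Real.logb 2 (∫ p, ((Finset.univ.filter fun u : Literature.Probability.LatticeModels.BoxVertex 3 L => (∀ i, -(2 ^ K : ℤ) ≤ (u : Literature.Probability.LatticeModels.Site 3) i ∧ (u : Literature.Probability.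
/-- item stmt-CriticalPhenomena-11354 · crux · rank 4 · open · by planner
why it might fail: a completely monotone 'staircase' G(t·e₁)=Σ_m A_m e^(−a_m t)/t obeys MMS, the gradient estimate DCP25 (1.11), DCP25 Thm 1.3 and c/t² ≤ G ≤ C/t, yet G(2^K e₁/3)/G(6·2^K e₁) = 2^(Θ(K)) along K_m → ∞; doubling/regularity is proved only at a positive density of scales (ADC21 Thm 5.12).
sources: AizenmanCMP1982, Literature.Probability.LatticeModels.currentSum_mul_currentSum_pair_holds, Literature.Probability.LatticeModels.twoPointPlus_le_of_mul_supNorm_le, Literature.Probability.LatticeModels.twoPointFree_criticalBeta_gradient_estimate, arXiv:1912.07973, DuminilcopinPanis2025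
[crux] (F), the card's (E4) in log form: (b_K − log₂ S_K)/K → 0, S_K = Σ_{u ∈ [−2^K,2^K)³}
⟨σ₀σ_u⟩⁺_{β_c(3)}. By SwitchingFirstMoment (support, exact) E_{K,L}[mass_K] = Σ_u
⟨σ₀σ_u⟩_L⟨σ_uσ_y⟩_L/⟨σ₀σ_y⟩_L; L → ∞ gives the infinite-volume free = plus state
(twoPointPlus_criticalBeta_eq_twoPointFree_holds), so F says the far-source weights ⟨σ_uσ_y⟩/⟨σ₀σ_y⟩
(u ∈ W_K, y = 2^(K+1)e₁) are 2^(o(K)): TEMPERED DOUBLING of the critical two-point function, G(2^K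
e₁/3)/G(6·2^K e₁) = 2^(o(K)). Necessary for the conclusion (η exists ⇒ F), so no loss. [difficulty:
L] NOTATION (rev-3 cone repair; statement DEFINITIONALLY unchanged): the vertex type ↥(box 3 (L+1))
is `BoxVertex 3 L` (abbrev) and the graph G_L := SimpleGraph.mk (fun a b => (zdGraph 3).Adj a.1 b.1
∧ ↑a ∈ box 3 L ∧ ↑b ∈ box 3 L) ⟨…⟩ ⟨…⟩ is `Literature.Probability.LatticeModels.freeBoxGraph 3 L`
unfolded (`rfl`); this decl ↔ the rev-2 item stmt-CriticalPhenomena-5734 by `Iff.rfl` (planner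
evidence SketchDefeq.lean, rc 0), so the grounding (grounder g13-38) and route-review check (refuter
ec82786d) recorded on stmt-CriticalPhenomena-5734 apply verbatim; provers may `show`/`change` to the
freeBoxGraph form and use DoubleCurrents / SourcedD -/
@[route_item "route-CriticalPhenomena-OctantEntropy"]
def FirstMomentBoxSum : Prop :=
  Filter.Tendsto (fun K : ℕ => (Filter.limsup (fun L : ℕ => Real.logb 2 (∫ p, ((Finset.univ.filter fun u : ↥(Literature.Probability.LatticeModels.box 3 (L + 1)) => (∀ i, -(2 ^ K : ℤ) ≤ (u : Literature.Probability.LatticeModels.Site 3) i ∧ (u : Literature.Probability.LatticeModels.Site 3) i < 2 ^ K) ∧ p ∈ Literature.Probability.LatticeModels.tracedConn ((SimpleGraph.mk (fun a b : ↥(Literature.Probability.LatticeModels.box 3 (L + 1)) => (Literature.Probability.LatticeModels.zdGraph 3).Adj a.1 b.1 ∧ (a : Literature.Probability.LatticeModels.Site 3) ∈ Literature.Probability.LatticeModels.box 3 L ∧ (b : Literature.Probability.LatticeModels.Site 3) ∈ Literature.Probability.LatticeModels.box 3 L) ⟨fun _ _ h => ⟨h.1.symm, h.2.2, h.2.1⟩⟩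 ⟨fun _ h => h.1.ne rfl⟩)) ⟨0, Literature.Probability.LatticeModels.zero_mem_box 3 (L + 1)⟩ u).card : ℝ) ∂(Literature.Probability.LatticeModels.doubleCurrentMeasure ((SimpleGraph.mk (fun a b : ↥(Literature.Probability.LatticeModels.box 3 (L + 1)) => (Literature.Probability.LatticeModels.zdGraph 3).Adj a.1 b.1 ∧ (a : Literature.Probability.LatticeModels.Site 3) ∈ Literature.Probability.LatticeModels.box 3 L ∧ (b : Literature.Probability.LatticeModels.Site 3) ∈ Literature.Probability.LatticeModels.box 3 L) ⟨fun _ _ h => ⟨h.1.symm, h.2.2, h.2.1⟩⟩ ⟨fun _ h => h.1.ne rfl⟩)) (Literature.Probability.LatticeModels.criticalBeta 3) (Finset.univ.filter fun v : ↥(Literature.Probability.LatticeModels.box 3 (L + 1)) => (v : Literature.Probability.LatticeModels.Site 3) = 0 ∨ (v : Literature.Probability.LatticeModels.Site 3) = Pi.single 0 (2 ^ (K + 1))) ∅))) Filter.atTop - Real.logb 2 (∑ u ∈ (Literature.Probability.LatticeModels.box 3 (2 ^ K)).filter (fun u : Literature.Probability.LatticeModels.Site 3 => ∀ i, u i < 2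 ^ K), Literature.Probability.LatticeModels.criticalTwoPoint 3 u)) / (K : ℝ)) Filter.atTop (nhds 0)

/-- item stmt-CriticalPhenomena-5735 · crux · rank 5 · open · by planner
why it might fail: η may exist while the conjunct fails: no uniqueness of subsequential limits beyond n ≤ 3; rotation invariance and inversion covariance are open for every critical lattice model on ℤ³ (ICM22 §8.1, §8.4); barrier ScaleCovarianceNotMoebius: Euclidean + scale covariance never force inversion.
sources: DuminilCopinICM2022, PolandRychkovVichi2019, Literature.Barriers.CriticalPhenomena.ScaleCovarianceNotMoebius, Literature.Probability.LatticeModels.isingScalingRelationHolds, Literature.Probability.LatticeModels.CritIsing3DEuclideanLimit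
[crux] IMPORTED COMPLEMENT (lowest of this route's own cruxes; this route does not attack it and
says so): if the anomalous dimension η of the critical Ising model on ℤ³ exists, then the critical
correlators have a non-degenerate Möbius-covariant pointwise scaling limit (ρ > 0 on (0,1], Δ > 0,
S) — the conjunct minus clause (iii), CONDITIONAL on item 0635. The consequent is verbatim the
shared complement MoebiusLimit (stmt-CriticalPhenomena-1344, routes AnomalousForcesInteraction /
PerfectScreening); the antecedent is what the engine supplies and is load-bearing: with η in hand
isingScalingRelationHolds pins Δ = (1+η)/2 for EVERY subsequential scale-covariant non-degenerate
limit (no competing Δ's) and fixes ρ(δ) up to slowly varying factors. [difficulty: open-problem] -/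
@[route_item "route-CriticalPhenomena-OctantEntropy"]
def EtaToMoebiusLimit : Prop :=
  (∃ η : ℝ, Literature.Probability.LatticeModels.HasIsingExponentEta 3 η) → ∃ (ρ : ℝ → ℝ) (Δ : ℝ) (S : Literature.Probability.LatticeModels.CorrFamily 3), (∀ δ ∈ Set.Ioc (0:ℝ) 1, 0 < ρ δ) ∧ 0 < Δ ∧ Literature.Probability.LatticeModels.HasPointwiseScalingLimit (Literature.Probability.LatticeModels.criticalCorr 3) ρ S ∧ Literature.Probability.LatticeModels.IsNondegenerateTwoPoint S ∧ Literature.Probability.LatticeModels.IsMoebiusCovariant Δ S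

/-- item stmt-CriticalPhenomena-0636 · crux · rank 6 · open · by planner
why it might fail: no proof that U₄ ≢ 0 in d=3: the double-current intersection probability at macroscopic separation must stay positive as δ→0 (ADC21 prove U₄→0 in d=4), and reflection-positive long-range models on ℤ³ with α<3/2 ARE Gaussian (LongRangeTrivialityOnZ3): no interaction-uniform argument works.
sources: AizenmanDuminilCopinAnnals2021, Panis2023Triviality, DuminilCopinICM2022, Literature.Barriers.CriticalPhenomena.IsingTrivialityFromDimensionFour, Literature.Barriers.CriticalPhenomena.LongRangeTrivialityOnZ3
Crux r4 (non-triviality in d=3): every non-degenerate pointwise scaling limit S of the renormalised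
critical Ising correlators on Z^3 has connected four-point function U4 ≢ 0 on non-coincident
configurations. Intended tool: the random-current identity U4(x,y,z,t) =
−2⟨σxσy⟩⟨σzσt⟩·P^{xy,zt}[C_{n1+n2}(x) ∩ C_{n1+n2}(z) ≠ ∅] (Aizenman 1982; ADC2021 arXiv:1912.07973
eq. (3.11)): non-Gaussianity ⇔ the intersection probability of the two double-current clusters at
macroscopic separation does not vanish as δ → 0. Contrast: for d ≥ 4 every such limit IS Gaussian
(Literature.Probability.LatticeModels.highDim_triviality). Its negation refutes the conjunct
Ising3DConformalLimit itself. -/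
@[route_item "route-CriticalPhenomena-OctantEntropy"]
def NonGaussianLimit : Prop :=
  ∀ (ρ : ℝ → ℝ) (S : Literature.Probability.LatticeModels.CorrFamily 3), (∀ δ ∈ Set.Ioc (0:ℝ) 1, 0 < ρ δ) → Literature.Probability.LatticeModels.HasPointwiseScalingLimit (Literature.Probability.LatticeModels.criticalCorr 3) ρ S → Literature.Probability.LatticeModels.IsNondegenerateTwoPoint S → Literature.Probability.LatticeModels.HasNontrivialU4 S

/-- item stmt-CriticalPhenomena-0635 · support · rank 9 · open · by planner
sources: DuminilCopinICM2022, DuminilcopinPanis2025, Literature.Probability.LatticeModels.HasIsingExponentEta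
Crux r3: the anomalous dimension η of the critical Ising model on Z^3 exists in the logarithmic
sense of Literature.Probability.LatticeModels.HasIsingExponentEta (log⟨σ0σx⟩_{β_c}/log|x| → −(1+η)).
Strictly weaker than r2; necessary for any single-Δ scaling limit (isingScalingRelationHolds: 2Δ = 1
+ η). Open (ICM2022 §1, §8). -/
@[route_item "route-CriticalPhenomena-OctantEntropy"]
def EtaExists : Prop :=
  ∃ η : ℝ, Literature.Probability.LatticeModels.HasIsingExponentEta 3 η

-- earlier SwitchingFirstMoment (stmt-CriticalPhenomena-5736, replaced 2026-08-15T17:24:43Z -> stmt-CriticalPhenomena-11355): retired by None — ∀ (K L : ℕ), 2 ^ (K + 1) ≤ L → ∀ (o y : Literature.Probability.LatticeModels.BoxVertex 3 L), (o : Literature.Probability.LatticeModels.Site 3) = 0 → (y : Literature.Probability.LatticeModels.Site 3) = Pi.single 0 (2 ^ (K + 1)) → ∫ p, ((Finset.univ.filter fun 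
/-- item stmt-CriticalPhenomena-11355 · support · rank 9 · closed · proved by Summit.CriticalPhenomena.Ising3DConformalLimit.Theorems.switchingFirstMoment_proof @ 8cfc01d3434a (prover) · by planner
sources: AizenmanCMP1982, GriffithsHurstSherman1970, DuminilCopin2016, Literature.Probability.LatticeModels.currentSum_mul_currentSum_pair_holds
[support] exact first-moment identity (card (E4), finite volume, provable now from the PROVED
switching lemma currentSum_mul_currentSum_pair_holds with A = {o,u}, and
isingTwoPoint_free_eq_currentSum_div_holds): for 2^(K+1) ≤ L, o = 0, y = 2^(K+1)e₁ in the free box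
graph of Λ_L at β_c(3), E_{K,L}[#(C_{n₁+n₂}(o) ∩ W_K)] = Σ_{u ∈ W_K} ⟨σ_oσ_u⟩⟨σ_uσ_y⟩/⟨σ_oσ_y⟩
(finite-volume free two-point functions; P^{oy,∅}[u ∈ C(o)] = ⟨σ_oσ_u⟩⟨σ_uσ_y⟩/⟨σ_oσ_y⟩ since o ↔ y
in n₁ always). [difficulty: provable-now] NOTATION (rev-3 cone repair; statement DEFINITIONALLY
unchanged): the vertex type ↥(box 3 (L+1)) is `BoxVertex 3 L` (abbrev) and the graph G_L :=
SimpleGraph.mk (fun a b => (zdGraph 3).Adj a.1 b.1 ∧ ↑a ∈ box 3 L ∧ ↑b ∈ box 3 L) ⟨…⟩ ⟨…⟩ is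
`Literature.Probability.LatticeModels.freeBoxGraph 3 L` unfolded (`rfl`); this decl ↔ the rev-2 item
stmt-CriticalPhenomena-5736 by `Iff.rfl` (planner evidence SketchDefeq.lean, rc 0), so the grounding
(grounder g13-38) and route-review check (refuter ec82786d) recorded on stmt-CriticalPhenomena-5736
apply verbatim; provers may `show`/`change` to the freeBoxGraph form and use DoubleCurrents /
SourcedDoubleCurrents(Switching) lemmas inside their Theorems -/
@[route_item "route-CriticalPhenomena-OctantEntropy"]
def SwitchingFirstMoment : Prop :=
  ∀ (K L : ℕ), 2 ^ (K + 1) ≤ L → ∀ (o y : ↥(Literature.Probability.LatticeModels.box 3 (L + 1))), (o : Literature.Probability.LatticeModels.Site 3) = 0 → (y : Literature.Probability.LatticeModels.Site 3) = Pi.single 0 (2 ^ (K + 1)) → ∫ p, ((Finset.univ.filter fun u : ↥(Literature.Probability.LatticeModels.box 3 (L + 1)) => (∀ i, -(2 ^ K : ℤ) ≤ (u : Literature.Probability.LatticeModels.Site 3) i ∧ (u : Literature.Probability.LatticeModels.Site 3) i < 2 ^ K) ∧ p ∈ Literature.Probability.LatticeModels.tracedConn ((SimpleGraph.mk (fun a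 b : ↥(Literature.Probability.LatticeModels.box 3 (L + 1)) => (Literature.Probability.LatticeModels.zdGraph 3).Adj a.1 b.1 ∧ (a : Literature.Probability.LatticeModels.Site 3) ∈ Literature.Probability.LatticeModels.box 3 L ∧ (b : Literature.Probability.LatticeModels.Site 3) ∈ Literature.Probability.LatticeModels.box 3 L) ⟨fun _ _ h => ⟨h.1.symm, h.2.2, h.2.1⟩⟩ ⟨fun _ h => h.1.ne rfl⟩)) ⟨0, Literature.Probability.LatticeModels.zero_mem_box 3 (L + 1)⟩ u).card : ℝ) ∂(Literature.Probability.LatticeModels.doubleCurrentMeasure ((SimpleGraph.mk (fun a b : ↥(Literature.Probability.LatticeModels.box 3 (L + 1)) => (Literature.Probability.LatticeModels.zdGraph 3).Adj a.1 b.1 ∧ (a : Literature.Probability.LatticeModels.Site 3) ∈ Literature.Probability.LatticeModels.box 3 L ∧ (b : Literature.Probability.LatticeModels.Site 3) ∈ Literature.Probability.LatticeModels.box 3 L) ⟨fun _ _ h => ⟨h.1.symm, h.2.2, h.2.1⟩⟩ ⟨fun _ h => h.1.ne rfl⟩)) (Literature.Probability.LatticeModels.criticalBeta 3) (Finset.univ.filter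 fun v : ↥(Literature.Probability.LatticeModels.box 3 (L + 1)) => (v : Literature.Probability.LatticeModels.Site 3) = 0 ∨ (v : Literature.Probability.LatticeModels.Site 3) = Pi.single 0 (2 ^ (K + 1))) ∅) = ∑ u ∈ Finset.univ.filter (fun u : ↥(Literature.Probability.LatticeModels.box 3 (L + 1)) => ∀ i, -(2 ^ K : ℤ) ≤ (u : Literature.Probability.LatticeModels.Site 3) i ∧ (u : Literature.Probability.LatticeModels.Site 3) i < 2 ^ K), Literature.Probability.LatticeModels.isingTwoPoint ((SimpleGraph.mk (fun a b : ↥(Literature.Probability.LatticeModels.box 3 (L + 1)) => (Literature.Probability.LatticeModels.zdGraph 3).Adj a.1 b.1 ∧ (a : Literature.Probability.LatticeModels.Site 3) ∈ Literature.Probability.LatticeModels.box 3 L ∧ (b : Literature.Probability.LatticeModels.Site 3) ∈ Literature.Probability.LatticeModels.box 3 L) ⟨fun _ _ h => ⟨h.1.symm, h.2.2, h.2.1⟩⟩ ⟨fun _ h => h.1.ne rfl⟩)) Finset.univ (Literature.Probability.LatticeModels.criticalBeta 3) 0 Literature.Probability.LatticeModels.BoundaryCondition.free o u * Literature.Probability.LatticeModels.isingTwoPoint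 ((SimpleGraph.mk (fun a b : ↥(Literature.Probability.LatticeModels.box 3 (L + 1)) => (Literature.Probability.LatticeModels.zdGraph 3).Adj a.1 b.1 ∧ (a : Literature.Probability.LatticeModels.Site 3) ∈ Literature.Probability.LatticeModels.box 3 L ∧ (b : Literature.Probability.LatticeModels.Site 3) ∈ Literature.Probability.LatticeModels.box 3 L) ⟨fun _ _ h => ⟨h.1.symm, h.2.2, h.2.1⟩⟩ ⟨fun _ h => h.1.ne rfl⟩)) Finset.univ (Literature.Probability.LatticeModels.criticalBeta 3) 0 Literature.Probability.LatticeModels.BoundaryCondition.free u y / Literature.Probability.LatticeModels.isingTwoPoint ((SimpleGraph.mk (fun a b : ↥(Literature.Probability.LatticeModels.box 3 (L + 1)) => (Literature.Probability.LatticeModels.zdGraph 3).Adj a.1 b.1 ∧ (a : Literature.Probability.LatticeModels.Site 3) ∈ Literature.Probability.LatticeModels.box 3 L ∧ (b : Literature.Probability.LatticeModels.Site 3) ∈ Literature.Probability.LatticeModels.box 3 L) ⟨fun _ _ h => ⟨h.1.symm, h.2.2, h.2.1⟩⟩ ⟨fun _ h => h.1.ne rfl⟩)) Finset.univ (Literature.Probability.LatticeModels.criticalBeta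 3) 0 Literature.Probability.LatticeModels.BoundaryCondition.free o y

-- `SwitchingFirstMoment` holds: proved by `Summit.CriticalPhenomena.Ising3DConformalLimit.Theorems.switchingFirstMoment_proof` @ 8cfc01d3434a (its module imports this route file, so no `_holds` link can be stated here).

/-- item stmt-CriticalPhenomena-5737 · support · rank 9 · closed · proved by Summit.CriticalPhenomena.Ising3DConformalLimit.Theorems.boxSumToEta_proof (prover) · by planner
sources: MessagerMiracleSoleJSP1977, Literature.Probability.LatticeModels.twoPointPlus_le_of_mul_supNorm_le, Literature.Probability.LatticeModels.card_box_mul_twoPointPlus_le_sum_box, Literature.Probability.LatticeModels.criticalTwoPoint_bounds_holds, Simon1980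
[support] Tauberian transfer, provable now: if log₂ S_K / K → s (S_K the dyadic-window two-point
sum) then η := 2 − s is the anomalous dimension, HasIsingExponentEta 3 η. Proof: S monotone in the
window ⇒ log S(R)/log R → s; upper bound G(x) ≤ S(‖x‖/3)/#Λ_{‖x‖/3} from
card_box_mul_twoPointPlus_le_sum_box (MMS, ‖y‖∞ ≥ 3‖x‖∞ ⇒ G(y) ≤ G(x)); lower bound G(x) ≥ (S(N) −
S(3‖x‖))/#Λ_N with N = (3‖x‖)^(1+ε) and S(N) ≥ 2S(3‖x‖) eventually because s ≥ 1 > 0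
(criticalTwoPoint_bounds_holds: c‖x‖⁻² ≤ G ≤ C‖x‖⁻¹); let ε → 0. [difficulty: provable-now] -/
@[route_item "route-CriticalPhenomena-OctantEntropy"]
def BoxSumToEta : Prop :=
  (∃ s : ℝ, Filter.Tendsto (fun K : ℕ => Real.logb 2 (∑ u ∈ (Literature.Probability.LatticeModels.box 3 (2 ^ K)).filter (fun u : Literature.Probability.LatticeModels.Site 3 => ∀ i, u i < 2 ^ K), Literature.Probability.LatticeModels.criticalTwoPoint 3 u) / (K : ℝ)) Filter.atTop (nhds s)) → ∃ η : ℝ, Literature.Probability.LatticeModels.HasIsingExponentEta 3 η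

-- `BoxSumToEta` holds: proved by `Summit.CriticalPhenomena.Ising3DConformalLimit.Theorems.boxSumToEta_proof` (its module imports this route file, so no `_holds` link can be stated here).

/-- item stmt-CriticalPhenomena-5738 · assembly · rank 1 · closed · proved by Summit.CriticalPhenomena.Ising3DConformalLimit.Theorems.octantEntropy_assembly_proof @ 736b119332e7 (prover) · by planner
sources: Furstenberg2008, AizenmanCMP1982, DuminilCopinICM2022
[assembly] QuenchedMassExponent → MonofractalMass → FirstMomentBoxSum → BoxSumToEta →
EtaToMoebiusLimit → NonGaussianLimit → Ising3DConformalLimit. -/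
@[route_item "route-CriticalPhenomena-OctantEntropy"]
def Assembly : Prop :=
  QuenchedMassExponent → MonofractalMass → FirstMomentBoxSum → BoxSumToEta → EtaToMoebiusLimit → NonGaussianLimit → Ising3DConformalLimit

-- `Assembly` holds: proved by `Summit.CriticalPhenomena.Ising3DConformalLimit.Theorems.octantEntropy_assembly_proof` @ 736b119332e7 (its module imports this route file, so no `_holds` link can be stated here).

/-! D-0027 §2.1 — DECIDING THEOREM (planner-authored via `route open/edit --closes-file`; by planner-rrepair-CriticalPhenomena-OctantEntrop-f1903d4f-g3-0 2026-08-15T17:24:43Z):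
its hypotheses are this route's items and its conclusion the sub-problem Statement (glue_lint), and it elaborates with this file. -/

@[closes "route-CriticalPhenomena-OctantEntropy"] theorem closes (hQ : QuenchedMassExponent) (hM : MonofractalMass) (hF : FirstMomentBoxSum)
    (hB : BoxSumToEta) (hC : EtaToMoebiusLimit) (hN : NonGaussianLimit) :
    _root_.Ising3DConformalLimit := by
  obtain ⟨D, hD⟩ := hQ
  have h1 := (hD.add hM).sub hF
  simp only [add_zero, sub_zero] at h1
  obtain ⟨η, hη⟩ := hB ⟨D, h1.congr fun K => by ring⟩
  obtain ⟨ρ, Δ, S, hρ, hΔ, hlim, hnd, hmob⟩ := hC ⟨η, hη⟩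
  exact ⟨ρ, Δ, S, hρ, hΔ, hlim, hnd, hmob, hN ρ S hρ hlim hnd⟩

end Summit.CriticalPhenomena.Ising3DConformalLimit.Theses.OctantEntropy
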